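import Summits.CriticalPhenomena.CardyFormulaZ2.Theorems.HalfPlaneMarkDensityLaw.Negative.MarkEvents
import Literature.Probability.Percolation.PlanarDuality
import Literature.Probability.Percolation.HarrisTheorem
import Literature.Probability.Percolation.RSW

/-!
# `HalfPlaneMarkDensityLaw` (crux stmt-CriticalPhenomena-5661), line `Sketch`:
# stub `stub_symmDiffInclusion` — the deterministic four-case inclusion

Moving the three integer marks `α, β, γ` of the first-hit event
`E = firstHit halfPlane (rowIcc α β) γ k` one site to the left changes the event only on lattice
configurations carrying a LEFT-ISOLATED ARM at `(k,0)` (joined inside the half-box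
`Λ⁺_R(k) = [k−R,k+R]×[0,R]` to its rim, with no vertex of `[k−R,k−1]×{0}` joined to `(k,0)` inside
the box) AND an isolated arm at one moved mark end (left-isolated at `β`, or right-isolated at
`α−1` or `γ−1`). Pure path combinatorics on bond-`ℤ²`: the first-exit lemma
`exists_openConnIn_exit` turns "joined in the half-plane to a far vertex" into "joined inside the
half-box to its rim" (`arm_of_far`), and isolation inside the box follows from isolation in the
half-plane by monotonicity (`iso_of`); the four cases are then bookkeeping with transitivity of
`openConnIn`.
-/

noncomputable section

namespace Summit.CriticalPhenomena.CardyFormulaZ2.Cruxes.HalfPlaneMarkDensityLaw.SketchLine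

open Literature.Probability.Percolation Literature.Probability.LatticeModels
open MeasureTheory Filter Set
open Summit.CriticalPhenomena.CardyFormulaZ2.Theorems.HalfPlaneMarkDensityLaw.Negative

namespace SymmDiff

/-- The half-box `Λ⁺_R(m) = [m−R, m+R] × [0, R]` around the boundary vertex `(m,0)`. [folklore] -/
def hbox (m : ℤ) (R : ℕ) : Set (Site 2) :=
  {v : Site 2 | 0 ≤ v 1 ∧ v 1 ≤ (R : ℤ) ∧ m - R ≤ v 0 ∧ v 0 ≤ m + R}

/-- The outer rim (left, right and top sides) of the half-box `Λ⁺_R(m)`. [folklore] -/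
def hrim (m : ℤ) (R : ℕ) : Set (Site 2) :=
  {v : Site 2 | v 0 = m - R ∨ v 0 = m + R ∨ v 1 = (R : ℤ)}

/-- Isolated arm at `(m,0)` to distance `R` with excluded boundary set `B`: `(m,0)` is joined inside
`Λ⁺_R(m)` to the rim, and no vertex of `B` is joined to `(m,0)` inside `Λ⁺_R(m)`. [folklore] -/
def iso (m : ℤ) (R : ℕ) (B : Set (Site 2)) : Set (BondConfig (Site 2)) :=
  openCrossing (hbox m R) {bpt m} (hrim m R) \ openCrossing (hbox m R) B {bpt m}

/-- First coordinate of `(k,0)`. [folklore] -/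
@[simp] lemma bpt_apply_zero (k : ℤ) : bpt k 0 = k := rfl

/-- Second coordinate of `(k,0)`. [folklore] -/
@[simp] lemma bpt_apply_one (k : ℤ) : bpt k 1 = 0 := rfl

/-- The centre `(m,0)` lies in its half-box. [folklore] -/
lemma bpt_mem_hbox (m : ℤ) (R : ℕ) : bpt m ∈ hbox m R := by
  simp only [hbox, mem_setOf_eq, bpt_apply_one, bpt_apply_zero]; omega

/-- The half-box lies in the half-plane. [folklore] -/
lemma hbox_subset_halfPlane (m : ℤ) (R : ℕ) : hbox m R ⊆ halfPlane := fun _ hv ↦ hv.1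

/-- Symmetry of `{x ↔ y in S}` as an implication. [folklore] -/
lemma conn_symm {ω : BondConfig (Site 2)} {S : Set (Site 2)} {x y : Site 2}
    (h : ω ∈ openConnIn S x y) : ω ∈ openConnIn S y x := by
  rw [openConnIn_comm]; exact h

/-- **Far arm.** For a lattice configuration, if `(m,0)` is joined inside the half-plane to a vertex
outside `Λ⁺_R(m)`, then `(m,0)` is joined inside `Λ⁺_R(m)` to its rim: follow the open lattice path
up to its first exit from the box; the last vertex before the exit is a lattice neighbour of a
half-plane vertex outside the box, hence lies on the rim. [folklore] -/
theorem arm_of_far {ω : BondConfig (Site 2)} (hω : ω ⊆ (zdGraph 2).edgeSet) {m : ℤ} {R : ℕ}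
    {w : Site 2} (hw : w ∉ hbox m R) (h : ω ∈ openConnIn halfPlane (bpt m) w) :
    ω ∈ openCrossing (hbox m R) {bpt m} (hrim m R) := by
  obtain ⟨u, w', hu, hw', hw'H, he, -, hconn⟩ :=
    exists_openConnIn_exit (T := hbox m R) (bpt_mem_hbox m R) hw h
  refine ⟨bpt m, rfl, u, ?_, openConnIn_mono inter_subset_right _ _ hconn⟩
  have hadj : (zdGraph 2).Adj u w' := (SimpleGraph.mem_edgeSet _).1 (hω he)
  simp only [hbox, halfPlane, mem_setOf_eq, not_and, not_le] at hu hw' hw'H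
  simp only [hrim, mem_setOf_eq]
  rcases (zdGraph_two_adj_iff u w').1 hadj with ⟨h0, h1⟩ | ⟨h0, h1⟩ | ⟨h1, h0⟩ | ⟨h1, h0⟩ <;> omega

/-- **Isolation transfer.** A far connection from `(m,0)` in the half-plane plus isolation of `(m,0)`
from `B` in the half-plane give the isolated-arm event `iso m R B` (isolation inside the box is
weaker than isolation in the half-plane, by monotonicity of `openConnIn`). [folklore] -/
theorem iso_of {ω : BondConfig (Site 2)} (hω : ω ⊆ (zdGraph 2).edgeSet) {m : ℤ} {R : ℕ}
    {w : Site 2} {B : Set (Site 2)} (hw : w ∉ hbox m R) (h : ω ∈ openConnIn halfPlane (bpt m) w)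
    (hB : ∀ v ∈ B, ω ∉ openConnIn halfPlane v (bpt m)) : ω ∈ iso m R B := by
  refine ⟨arm_of_far hω hw h, ?_⟩
  rintro ⟨v, hv, y, hy, hvy⟩
  obtain rfl : y = bpt m := hy
  exact hB v hv (openConnIn_mono (hbox_subset_halfPlane m R) _ _ hvy)

/-- Case (0): on a first-hit event whose source arc `[α',β']×{0}` lies left of the box
(`β' + R < k`) and whose excluded window starts at `γ' ≤ k − R`, `(k,0)` carries a left-isolated
arm to distance `R`. [folklore] -/
theorem leftIso_of_firstHit {ω : BondConfig (Site 2)} (hω : ω ⊆ (zdGraph 2).edgeSet)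
    {α' β' γ' k : ℤ} {R : ℕ} (hβ : β' + R < k) (hγ : γ' + R ≤ k)
    (h : ω ∈ firstHit halfPlane (rowIcc α' β') γ' k) : ω ∈ iso k R (rowIcc (k - R) (k - 1)) := by
  obtain ⟨⟨x, hx, y, hy, hxy⟩, hnot⟩ := h
  obtain rfl : y = bpt k := hy
  obtain ⟨hx1, hx0, hx0'⟩ := hx
  refine iso_of hω (w := x) ?_ (conn_symm hxy) ?_
  · rintro ⟨-, -, h3, -⟩; omega
  · rintro v ⟨hv1, hv0, hv0'⟩ hv
    exact hnot ⟨x, ⟨hx1, hx0, hx0'⟩, v, ⟨hv1, by omega, by omega⟩,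
      PlanarDuality.openConnIn_trans hxy (conn_symm hv)⟩

/-- **The four-case inclusion** (folded form): on the symmetric difference of the two first-hit
events, `(k,0)` is left-isolated and one moved mark end carries an isolated arm. [folklore] -/
theorem mem_iso_of_mem_symmDiff {ω : BondConfig (Site 2)} (hω : ω ⊆ (zdGraph 2).edgeSet)
    {α β γ k : ℤ} {R : ℕ} (h₁ : (R : ℤ) ≤ β - α + 1) (h₂ : (R : ℤ) + 2 ≤ γ - β)
    (h₃ : 2 * (R : ℤ) + 1 ≤ k - γ)
    (hmem : ω ∈ symmDiff (firstHit halfPlane (rowIcc α β) γ k)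
      (firstHit halfPlane (rowIcc (α - 1) (β - 1)) (γ - 1) k)) :
    ω ∈ iso k R (rowIcc (k - R) (k - 1)) ∩
      (iso β R (rowIcc (β - R) (β - 1)) ∪ iso (α - 1) R (rowIcc ((α - 1) + 1) ((α - 1) + R)) ∪
        iso (γ - 1) R (rowIcc ((γ - 1) + 1) ((γ - 1) + R))) := by
  rcases Set.mem_symmDiff.1 hmem with ⟨hE, hE'⟩ | ⟨hE', hE⟩
  · -- (1) `ω ∈ E \ E'`
    refine ⟨leftIso_of_firstHit hω (by omega) (by omega) hE, ?_⟩
    obtain ⟨⟨x, hx, y, hy, hxy⟩, hnC⟩ := hE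
    obtain rfl : y = bpt k := hy
    by_cases hA' : ω ∈ openCrossing halfPlane (rowIcc (α - 1) (β - 1)) {bpt k}
    · -- (1b) some vertex of `[γ−1,k)×{0}` is joined to the moved arc
      have hC' : ω ∈ openCrossing halfPlane (rowIcc (α - 1) (β - 1)) (rowIco (γ - 1) k) := by
        by_contra hC'; exact hE' ⟨hA', hC'⟩
      obtain ⟨x', hx', y', hy', hx'y'⟩ := hC'
      obtain ⟨hy'1, hy'0, hy'0'⟩ := hy'
      obtain ⟨hx'1, hx'0, hx'0'⟩ := hx'
      by_cases hz : ∃ z ∈ rowIcc α β, ω ∈ openConnIn halfPlane z y'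
      · -- `y' = (γ−1, 0)` is joined to the old arc: right-isolated arm at `γ − 1`
        obtain ⟨z, hz, hzy'⟩ := hz
        obtain ⟨hz1, hz0, hz0'⟩ := hz
        have hy'eq : y' = bpt (γ - 1) := by
          rw [site_eq_bpt_iff]
          refine ⟨hy'1, ?_⟩
          by_contra hne
          exact hnC ⟨z, ⟨hz1, hz0, hz0'⟩, y', ⟨hy'1, by omega, hy'0'⟩, hzy'⟩
        subst hy'eq
        refine Or.inr (iso_of hω (w := z) ?_ (conn_symm hzy') ?_)
        · rintro ⟨-, -, h3, -⟩; omega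
        · rintro v ⟨hv1, hv0, hv0'⟩ hv
          exact hnC ⟨z, ⟨hz1, hz0, hz0'⟩, v, ⟨hv1, by omega, by omega⟩,
            PlanarDuality.openConnIn_trans hzy' (conn_symm hv)⟩
      · -- otherwise `x' = (α−1, 0)`: right-isolated arm at `α − 1`
        push Not at hz
        have hx'eq : x' = bpt (α - 1) := by
          rw [site_eq_bpt_iff]
          refine ⟨hx'1, ?_⟩
          by_contra hne
          exact hz x' ⟨hx'1, by omega, by omega⟩ hx'y'
        subst hx'eq
        refine Or.inl (Or.inr (iso_of hω (w := y') ?_ hx'y' ?_))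
        · rintro ⟨-, -, -, h4⟩; omega
        · rintro v ⟨hv1, hv0, hv0'⟩ hv
          exact hz v ⟨hv1, by omega, by omega⟩ (PlanarDuality.openConnIn_trans hv hx'y')
    · -- (1a) `(k,0)` is joined to the old arc only through `(β,0)`: left-isolated arm at `β`
      obtain ⟨hx1, hx0, hx0'⟩ := hx
      have hxeq : x = bpt β := by
        rw [site_eq_bpt_iff]
        refine ⟨hx1, ?_⟩
        by_contra hne
        exact hA' ⟨x, ⟨hx1, by omega, by omega⟩, bpt k, rfl, hxy⟩
      subst hxeq
      refine Or.inl (Or.inl (iso_of hω (w := bpt k) ?_ hxy ?_))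
      · rintro ⟨-, -, -, h4⟩; simp only [bpt_apply_zero] at h4; omega
      · rintro v ⟨hv1, hv0, hv0'⟩ hv
        exact hA' ⟨v, ⟨hv1, by omega, by omega⟩, bpt k, rfl, PlanarDuality.openConnIn_trans hv hxy⟩
  · -- (2) `ω ∈ E' \ E`
    refine ⟨leftIso_of_firstHit hω (by omega) (by omega) hE', ?_⟩
    obtain ⟨⟨x, hx, y, hy, hxy⟩, hnC'⟩ := hE'
    obtain rfl : y = bpt k := hy
    by_cases hA : ω ∈ openCrossing halfPlane (rowIcc α β) {bpt k}
    · -- (2b) some vertex of `[γ,k)×{0}` is joined to the old arc, necessarily to `(β,0)`: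
      -- left-isolated arm at `β`
      have hC : ω ∈ openCrossing halfPlane (rowIcc α β) (rowIco γ k) := by
        by_contra hC; exact hE ⟨hA, hC⟩
      obtain ⟨x', hx', y', hy', hx'y'⟩ := hC
      obtain ⟨hy'1, hy'0, hy'0'⟩ := hy'
      obtain ⟨hx'1, hx'0, hx'0'⟩ := hx'
      have hx'eq : x' = bpt β := by
        rw [site_eq_bpt_iff]
        refine ⟨hx'1, ?_⟩
        by_contra hne
        exact hnC' ⟨x', ⟨hx'1, by omega, by omega⟩, y', ⟨hy'1, by omega, hy'0'⟩, hx'y'⟩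
      subst hx'eq
      refine Or.inl (Or.inl (iso_of hω (w := y') ?_ hx'y' ?_))
      · rintro ⟨-, -, -, h4⟩; omega
      · rintro v ⟨hv1, hv0, hv0'⟩ hv
        exact hnC' ⟨v, ⟨hv1, by omega, by omega⟩, y', ⟨hy'1, by omega, hy'0'⟩,
          PlanarDuality.openConnIn_trans hv hx'y'⟩
    · -- (2a) `(k,0)` is joined to the moved arc only through `(α−1,0)`: right-isolated arm at `α − 1`
      obtain ⟨hx1, hx0, hx0'⟩ := hx
      have hxeq : x = bpt (α - 1) := by
        rw [site_eq_bpt_iff]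
        refine ⟨hx1, ?_⟩
        by_contra hne
        exact hA ⟨x, ⟨hx1, by omega, by omega⟩, bpt k, rfl, hxy⟩
      subst hxeq
      refine Or.inl (Or.inr (iso_of hω (w := bpt k) ?_ hxy ?_))
      · rintro ⟨-, -, -, h4⟩; simp only [bpt_apply_zero] at h4; omega
      · rintro v ⟨hv1, hv0, hv0'⟩ hv
        exact hA ⟨v, ⟨hv1, by omega, by omega⟩, bpt k, rfl, PlanarDuality.openConnIn_trans hv hxy⟩

end SymmDiff

/-- STUB I (deterministic four-case inclusion, configuration-wise, for lattice configurations): moving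
the three integer marks one site to the left changes the first-hit event at `k` only on configurations
with a left-isolated arm at `k` AND an isolated arm at one moved mark end, in half-boxes of radius `R`.
[folklore] -/
theorem stub_symmDiffInclusion :
    ∀ (α β γ k : ℤ) (R : ℕ), 1 ≤ R → (R : ℤ) ≤ β - α + 1 → (R : ℤ) + 2 ≤ γ - β →
      2 * (R : ℤ) + 1 ≤ k - γ → ∀ ω : BondConfig (Site 2), ω ⊆ (zdGraph 2).edgeSet →
      ω ∈ symmDiff (firstHit halfPlane (rowIcc α β) γ k)
              (firstHit halfPlane (rowIcc (α - 1) (β - 1)) (γ - 1) k) →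
      ω ∈ (openCrossing {v : Site 2 | 0 ≤ v 1 ∧ v 1 ≤ (R : ℤ) ∧ k - R ≤ v 0 ∧ v 0 ≤ k + R} {bpt k}
              {v : Site 2 | v 0 = k - R ∨ v 0 = k + R ∨ v 1 = (R : ℤ)} \
            openCrossing {v : Site 2 | 0 ≤ v 1 ∧ v 1 ≤ (R : ℤ) ∧ k - R ≤ v 0 ∧ v 0 ≤ k + R}
              (rowIcc (k - R) (k - 1)) {bpt k}) ∩
          ((openCrossing {v : Site 2 | 0 ≤ v 1 ∧ v 1 ≤ (R : ℤ) ∧ β - R ≤ v 0 ∧ v 0 ≤ β + R} {bpt β}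
                {v : Site 2 | v 0 = β - R ∨ v 0 = β + R ∨ v 1 = (R : ℤ)} \
              openCrossing {v : Site 2 | 0 ≤ v 1 ∧ v 1 ≤ (R : ℤ) ∧ β - R ≤ v 0 ∧ v 0 ≤ β + R}
                (rowIcc (β - R) (β - 1)) {bpt β}) ∪
            (openCrossing {v : Site 2 | 0 ≤ v 1 ∧ v 1 ≤ (R : ℤ) ∧ (α - 1) - R ≤ v 0 ∧ v 0 ≤ (α - 1) + R}
                {bpt (α - 1)} {v : Site 2 | v 0 = (α - 1) - R ∨ v 0 = (α - 1) + R ∨ v 1 = (R : ℤ)} \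
              openCrossing {v : Site 2 | 0 ≤ v 1 ∧ v 1 ≤ (R : ℤ) ∧ (α - 1) - R ≤ v 0 ∧ v 0 ≤ (α - 1) + R}
                (rowIcc ((α - 1) + 1) ((α - 1) + R)) {bpt (α - 1)}) ∪
            (openCrossing {v : Site 2 | 0 ≤ v 1 ∧ v 1 ≤ (R : ℤ) ∧ (γ - 1) - R ≤ v 0 ∧ v 0 ≤ (γ - 1) + R}
                {bpt (γ - 1)} {v : Site 2 | v 0 = (γ - 1) - R ∨ v 0 = (γ - 1) + R ∨ v 1 = (R : ℤ)} \
              openCrossing {v : Site 2 | 0 ≤ v 1 ∧ v 1 ≤ (R : ℤ) ∧ (γ - 1) - R ≤ v 0 ∧ v 0 ≤ (γ - 1) + R}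
                (rowIcc ((γ - 1) + 1) ((γ - 1) + R)) {bpt (γ - 1)})) := by
  intro α β γ k R _ h₁ h₂ h₃ ω hω hmem
  exact SymmDiff.mem_iso_of_mem_symmDiff hω h₁ h₂ h₃ hmem

end Summit.CriticalPhenomena.CardyFormulaZ2.Cruxes.HalfPlaneMarkDensityLaw.SketchLine
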